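import Literature.AnabelianGeometry.EtaleTheta.MuTwoSettingCLevel
import Literature.AnabelianGeometry.SemiGraphs.TemperedCompletionExtension
import Literature.AnabelianGeometry.SemiGraphs.TemperedAnabelianWitness
import HarnessLib

/-!
# [EtTh] §2 over §1: the profinite augmentation `Π_C ↠ G_K` of a profinite completion of `Π^tp_C`
# (proof-only; W3-L2-02 phase-2 plumbing for the `aug` field of `ThetaCovers.CoverData` at the model)

Mochizuki, *The étale theta function and its Frobenioid-theoretic manifestations*, Publ. RIMS **45**
(2009), §2 p. 36 (printed 262): "`Δ_C := Ker(Π_C ↠ G_K)` … `1 → Δ_X → Π_X → G_K → 1`"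
[cite: MochizukiEtTh2009, Def 2.1 p.36].

Cell abc-iut, layer L2, W3-L2-02 (seat abc-iut-L2-d3), PROOF-ONLY companion (no `def`) of
`MuTwoSettingCLevel.lean`. For `e : M.CLevelData` (augmentation `augC : Π^tp_C → G_{ℚ_p}` of image `G_K`)
and ANY profinite completion `ιC : Π^tp_C → P_C` (L3 `IsProfiniteCompletion`), PROVED:

* `exists_augHatC` / `augHatC_unique` — the continuous extension `A : P_C → G_{ℚ_p}` of `augC` along `ιC`
  (`G_{ℚ_p}` is profinite: L3 `isProfiniteCompletion_id_GQp`; L3 `exists_extension`);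
* `range_augHatC` — its image is EXACTLY `G_K` (closure of `augC(Π^tp_C) = G_K`, which is closed) — the
  shape of `CoverData.aug : Π_C →* G_K` with `aug_PiX_surjective`;
* `augHatC_hatInclX` — compatibility with the `Π_X`-side profinite augmentation of the tree's
  `TemperedCurve`: `A (Φ z) = augHat z` for the transport `Φ : Π_X → P_C` of `Sec2PiXIntoPiC`
  (both sides extend `aug` along `toHat`; uniqueness of extensions).

Nothing here asserts that a `MuTwoSetting` exists; no side is taken on [IUTchIII] Cor. 3.12; typed ≠ proved.
-/

noncomputable section

namespace Literature.AnabelianGeometry.EtaleTheta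

open Literature.AnabelianGeometry.SemiGraphs
open _root_.Topology

namespace MuTwoSetting.CLevelData

universe w

variable {p : ℕ} [Fact p.Prime] {M : MuTwoSetting p}
variable {PC : Type w} [Group PC] [TopologicalSpace PC] [IsTopologicalGroup PC]

/-- **The profinite augmentation `A : P_C → G_{ℚ_p}` extending `augC` along `ιC`** exists.
[cite: MochizukiEtTh2009, Def 2.1 p.36] -/
theorem exists_augHatC (e : M.CLevelData) (ιC : M.GtpC →ₜ* PC) (hιC : IsProfiniteCompletion ιC) :
    ∃ A : PC →ₜ* GQp p, ∀ g : M.GtpC, A (ιC g) = e.augC g := by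
  haveI : CompactSpace (GQp p) := (isProfiniteCompletion_id_GQp (p := p)).compactSpace
  haveI : TotallyDisconnectedSpace (GQp p) :=
    (isProfiniteCompletion_id_GQp (p := p)).totallyDisconnectedSpace
  exact IsProfiniteCompletion.exists_extension hιC e.augC

omit [IsTopologicalGroup PC] in
/-- The profinite augmentation is unique. [cite: MochizukiEtTh2009, Def 2.1 p.36] -/
theorem augHatC_unique (e : M.CLevelData) (ιC : M.GtpC →ₜ* PC) (hιC : IsProfiniteCompletion ιC)
    (A B : PC →ₜ* GQp p) (hA : ∀ g : M.GtpC, A (ιC g) = e.augC g)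
    (hB : ∀ g : M.GtpC, B (ιC g) = e.augC g) : A = B := by
  haveI : T2Space (GQp p) := (isProfiniteCompletion_id_GQp (p := p)).t2Space
  exact IsProfiniteCompletion.extension_unique hιC A B fun g => by rw [hA, hB]

omit [IsTopologicalGroup PC] in
/-- **The image of the profinite augmentation is exactly `G_K`** ("`1 → Δ_C → Π_C → G_K → 1`", p. 36):
`A(P_C)` is the closure of `augC(Π^tp_C) = G_K` (field `range_augC`), and `G_K` is closed in `G_{ℚ_p}`.
[cite: MochizukiEtTh2009, Def 2.1 p.36] -/
theorem range_augHatC (e : M.CLevelData) (ιC : M.GtpC →ₜ* PC) (hιC : IsProfiniteCompletion ιC)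
    (A : PC →ₜ* GQp p) (hA : ∀ g : M.GtpC, A (ιC g) = e.augC g) :
    A.toMonoidHom.range = M.GK := by
  haveI : CompactSpace PC := hιC.compactSpace
  haveI : T2Space (GQp p) := (isProfiniteCompletion_id_GQp (p := p)).t2Space
  haveI := M.finiteDimensional_K
  have hclosed : IsClosed (M.GK : Set (GQp p)) := M.K.fixingSubgroup_isClosed
  have himg : A '' Set.range ιC = (M.GK : Set (GQp p)) := by
    rw [← e.range_augC]
    ext σ
    constructor
    · rintro ⟨_, ⟨g, rfl⟩, rfl⟩
      exact ⟨g, (hA g).symm⟩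
    · rintro ⟨g, rfl⟩
      exact ⟨ιC g, ⟨g, rfl⟩, hA g⟩
  apply SetLike.coe_injective
  rw [MonoidHom.coe_range]
  change Set.range A = (M.GK : Set (GQp p))
  apply le_antisymm
  · have hd : closure (Set.range ιC) = Set.univ := hιC.denseRange.closure_range
    rw [← hclosed.closure_eq, ← himg, ← Set.image_univ, ← hd]
    exact image_closure_subset_closure_image A.continuous
  · rw [← himg]
    exact Set.image_subset_range _ _

omit [IsTopologicalGroup PC] in
/-- Every value of the profinite augmentation lies in `G_K`. [cite: MochizukiEtTh2009, Def 2.1 p.36] -/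
theorem augHatC_mem_GK (e : M.CLevelData) (ιC : M.GtpC →ₜ* PC) (hιC : IsProfiniteCompletion ιC)
    (A : PC →ₜ* GQp p) (hA : ∀ g : M.GtpC, A (ιC g) = e.augC g) (z : PC) : A z ∈ M.GK := by
  rw [← e.range_augHatC ιC hιC A hA]
  exact ⟨z, rfl⟩

omit [IsTopologicalGroup PC] in
/-- **Compatibility with the `Π_X`-side profinite augmentation**: for the transport `Φ : Π_X → P_C` of
`ιC ∘ inclX` (`Sec2PiXIntoPiC.exists_hatInclX`), `A ∘ Φ = augHat` — both are continuous extensions of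
`aug : Π^tp_X → G_{ℚ_p}` along `toHat` (`augC ∘ inclX = aug`, field `augC_inclX`; `augHat ∘ toHat = aug`,
`TemperedCurve.augHat_comp`). [cite: MochizukiEtTh2009, Def 2.1 p.36] -/
theorem augHatC_hatInclX (e : M.CLevelData) (ιC : M.GtpC →ₜ* PC) (A : PC →ₜ* GQp p)
    (hA : ∀ g : M.GtpC, A (ιC g) = e.augC g) (Φ : M.PiHat →ₜ* PC)
    (hΦ : ∀ x : M.PiTemp, Φ (M.toHat x) = ιC (M.inclX x)) (z : M.PiHat) : A (Φ z) = M.augHat z := by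
  haveI : T2Space (GQp p) := (isProfiniteCompletion_id_GQp (p := p)).t2Space
  have h := IsProfiniteCompletion.extension_unique M.isProfiniteCompletion_toHat (A.comp Φ) M.augHat
    fun x => by
      change A (Φ (M.toHat x)) = M.augHat (M.toHat x)
      rw [hΦ, hA, e.augC_inclX, M.augHat_comp]
  exact DFunLike.congr_fun h z

end MuTwoSetting.CLevelData

end Literature.AnabelianGeometry.EtaleTheta

end
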